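import Summits.BirchSwinnertonDyer.BirchSwinnertonDyer.Theorems.EisensteinPrimesBSDpOnCellCOfNamedFactsV10
import Summits.BirchSwinnertonDyer.BirchSwinnertonDyer.Theorems.EisensteinPrimesBSDpOnCellCResidualPub
import Summits.BirchSwinnertonDyer.BirchSwinnertonDyer.Theorems.EisensteinPrimesBSDpOnCellCStubC3RoadHOther
import HarnessLib

/-!
# Crux 4 `BSDpOnCellC` (stmt-BirchSwinnertonDyer-19034) — line «conglim» v1.1 (UNREGISTERED; ideator seat bsd-idea-12 g24, W-71/W-79)

ROAD H (the Greenberg / Skinner–Urban direction, in Fitting form, at `𝔭̄`) RE-TARGETED AT THE RECORD'S WALL.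
The record line «crystal» v10 (sha256 7b9d525c…, 6 stubs; v11 DRAFT 5 stubs) closes the crux through the
KOLYVAGIN road: `stub_twoVarRatDivPNew` (`CellC W p → TwoVarRatDivPNew W p`, the one NEW / unprinted stub,
two-variable Beilinson–Flach accumulation) gives `Ch_Λ(X_ac^∅ strict at 𝔭̄)♭ ∣ p^k · Q`, and the tree supplies
the LOWER imprimitive count `λ(Q) + Σ_w λ𝒫_w ≤ λ(X_ac^{Sf})` + Keller–Yin Lemma 5.1.1 + the `μ`-frame.
This line replaces the road and mirrors the count:

* `stub_roadHFittingRevDiv` — at every X2c Heegner datum and every `𝓞_{ℂ_p}`-frame `Q` at `(ι′, 𝔭)`: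
  `(Fitt_Λ X_ac^∅ strict at 𝔭̄) · 𝓞_{ℂ_p}⟦T⟧ ⊆ (Q)` — the binder `hfitt` of the tree theorem
  `Theorems.hidaLimitRevDivOnTreeIntOther_of_map_fittingIdeal_le` (c3h g4, §4) TOKEN FOR TOKEN. Intended
  proof (crux idea card `Cruxes/BSDpOnCellC/Ideas/conglim.md`, S1–S4): Castella's member package on the Hida
  branch through `f_E` (`Castella2018.erratum_members_exists_isTorsion_charIdeal_le_congruence_OPEN` is the
  typed IRREDUCIBLE twin; here `E[p]` is reducible, so the members are the crystalline CM-congruent forms of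
  `cas20_thm211_memberForms_sigmaFrames_congr`), member-wise ONE-SIDED divisibility `Ch(X(g_m)^Σ) ⊆ (L_Σ(g_m))`
  (Greenberg direction, Wan / Castella Thm. 2.3 shape), Selmer specialisation congruences `e_m`, and the
  bsd-stepL congruence-limit kernel `Castella2018.AcSelmer.XAc.map_fittingIdeal_le_span_of_oneSided_congruences_descent_le_cpInt`
  (landed) which turns «member containments mod `(ϖ^m)` for all `m`» into the Fitting containment in the limit,
  then the Σ-strip at `𝔭̄`.
* `stub_lambdaUpperNonsplit` / `stub_lambdaUpperSplit` — per datum and frame: `Q` has its first unit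
  coefficient at `m` ⟹ `λ(X_ac^∅ strict at 𝔭̄) ≤ m` (the UPPER half of Keller–Yin `algmain` at the p-new
  point). Non-split: = tree EQUALITY `GrSelmerQuotientCorankLe.lambdaInvariant_xAc_eq_add_add_sum_of_not_split_of_facts`
  + `stub_wallAlgebraic` + the member analytic count (ii) read as an equality + the `≥` HALF of the f-side
  Σ-relaxation `λ(X^∅) + Σ_w λ𝒫_w(f) ≤ λ(X^{Sf})`, i.e. `corank_{ℤ_p}(Sel^{Sf}/Sel^∅) ≥ Σ_w λ𝒫_w(f)` (global-to-local
  SURJECTIVITY for the `Sf`-relaxed anticyclotomic deformation of `T_pE`: Greenberg 2016 Prop. 2.6.3 =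
  `prop263_sur_of_crk`, PUB conjunct of `stub_publishedFacts.2`, with the tree's curve-level packaging
  `AcTwistDeformationCurveSUR.primaryTorsion_fullAt_SUR` pattern and the corank algebra of
  `UnrSelmerQuotientCorankGeOfSurjective`; the record needs only the `≤` half, which is KERNEL: p564629 + p620653).
  Split: additionally the UPPER half of the split-row devissage count with the `−δ` correction (mirror of
  `SplitMultAlgebraicSide.lambdaInvariant_primitive_add_sum_le_of_split`; unprinted as stated).
* `stub_publishedFacts`, `stub_memberInvariants`, `stub_wallAlgebraic`, `stub_mazurMC_cellB` — the record's
  (crystal v10) texts VERBATIM; they feed Keller–Yin Lemma 5.1.1 (`μ(X^{S}) = 0`,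
  `KellerYinLemma511OfBrAnom.lemma511_OPEN_of_prop125_of_brAnom_of_pub`), the `μ`-frame of `Q`
  (`CrystalTransports.muFrame_of_crystallineFibre_of_memberMuZero`) and crux 3.

COMPOSITION (kernel-checked, zero binders, no sorry outside the seven `stub_*`): Lemma 5.1.1 ⟹ `μ(X_ac^∅ at 𝔭̄) = 0`
(`StubC3MultMuLemma.stub_muSelmer_of_lemma511_OPEN`); `μ`-frame ⟹ `∃ m`, `Q` fuc at `m`; the two `λ`-upper stubs
⟹ the ROAD-H one-inequality «`μ = 0 ∧ ∃ m ≥ λ(X_ac^∅), Q fuc at m`»; `stub_roadHFittingRevDiv` ⟹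
`X2.HidaLimitRevDivOnTreeIntOther W p` on X2c (c3h §4, torsion of `X_ac^∅` at `𝔭̄` DISCHARGED from GZK +
modularity + Poitou–Tate, the latter two tree theorems); x2-p2 g2's
`BSDpOnCellCResidualPub.stub_c3_of_pub_of_hidaLimitRevDivIntOther_of_oneInequality` ⟹ the IMC atom `stub_c3`
(both signs, `X2.Nonsplit/SplitIMCEqOnTreeIntOther`); `Reoriented.bsdpOnCellC_of_stubs_reoriented` + LZZ ⟹ the crux
BY NAME. ORIENTATION: only the `…IntOther` predicates (RULINGS L31/L33).

HONEST FRAMING: CONDITIONAL skeleton; nothing about any curve is asserted; BSD and the main conjectures are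
proved for NO curve by this file; no label or count moves; NOT registered (`ledger skeleton check` is the LEAD's,
W-79); the record skeleton crystal v10 is untouched. What this line buys and costs relative to the record is
stated in `Lines/conglim.md`: it trades the record's ONE unprinted stub (`stub_twoVarRatDivPNew`, no typed
template in the tree) for ONE member-level road-H stub WITH a typed template and landed limit kernel
(`stub_roadHFittingRevDiv`) plus TWO `λ`-upper stubs (non-split: tree pieces exist, kernel M; split: one
unprinted devissage half, kernel L).

References: [KellerYin2024] §3, §5.1, Lemma 5.1.1/5.1.2, Thm. 5.1.3 (arXiv:2402.12781v2; PRE — shape only);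
[Castella2018] Thm. 2.3 and the 2020 erratum (members); [JetchevSkinnerWan2017] §5.3.4–5.3.8; [SkinnerUrban2014]
§3.1.6; [Wan2020] (Greenberg-direction three-variable divisibility); [CastellaGrossiLeeSkinner2022] Prop. 1.2.5,
Thm. 1.2.2; cell bsd-eis RULINGS L31/L33; tree: c3h g4 `…StubC3RoadHOther`, x2-p2 g2 `…ResidualPub`, LEAD
`…OfNamedFactsV10`, bsd-stepL `ErratumRoadFiveIMCDivCongruenceDescentCpInt`.
-/

set_option autoImplicit false
set_option linter.dupNamespace false

noncomputable section


open scoped Classical MatrixGroups ModularForm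

open CongruenceSubgroup WeierstrassCurve NumberField IsDedekindDomain Field PowerSeries
  Literature.NumberTheory.EllipticCurves Literature.NumberTheory.EllipticCurves.GreenbergSelmer
  Literature.NumberTheory.EllipticCurves.ModularForms Literature.NumberTheory.QuadraticFields
  Literature.NumberTheory.EllipticCurves.Rank1Residual
  Literature.NumberTheory.EllipticCurves.Rank1Residual.Typed
  Literature.NumberTheory.EllipticCurves.KrizLi2019
  Literature.NumberTheory.EllipticCurves.GreenbergVatsal2000
  Literature.NumberTheory.EllipticCurves.Wuthrich2014
  Literature.NumberTheory.EllipticCurves.SteinWuthrich2013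
  Literature.NumberTheory.EllipticCurves.Castella2018Exceptional
  Literature.NumberTheory.GaloisRepresentations Literature.NumberTheory.GaloisCohomology
  Literature.NumberTheory.Automorphic
  Summit.BirchSwinnertonDyer.Rank1Residual.X11b.AcSelmer
  Summit.BirchSwinnertonDyer.Rank1Residual.X11b.Halves
  Summit.BirchSwinnertonDyer.Rank1Residual.X11b
  Summit.BirchSwinnertonDyer.Rank1Residual Summit.BirchSwinnertonDyer.Rank1Residual.X1
  Summit.BirchSwinnertonDyer.Rank1Residual.X2
open Literature.NumberTheory.EllipticCurves.KellerYin2024 (curveLocalLambda)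



namespace Summit.BirchSwinnertonDyer.BirchSwinnertonDyer.Cruxes.BSDpOnCellC.Conglim

open Literature.NumberTheory.EllipticCurves.CastellaGrossiLeeSkinner2022 Literature.NumberTheory.EllipticCurves.Castella2018
  Literature.NumberTheory.IwasawaTheory Literature.NumberTheory.IwasawaTheory.Greenberg2016
  Literature.NumberTheory.IwasawaTheory.Greenberg2006
  Summit.BirchSwinnertonDyer.Rank1Residual.X1.KellerYinMuLambdaSplit
open Literature.NumberTheory.EllipticCurves.KellerYin2024

/-- **stub_publishedFacts** := the record's (crystal v10) `stub_publishedFacts` VERBATIM — 26 REGISTERED published named facts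
(b1's block ∧ `thm210_thm211_bdpDisplay_pNew` ∧ LZZ) ∧ (Greenberg 2016/2006, CGLS 2022 Prop. 1.2.5 / Cor. 1.2.6 ×2 / Thm. 2.1.2 / Thm. 1.2.2 ×2,
Castella 2020 Thm. 2.11 member frames). Fact-grade. [cite: Hsieh2014, Thm. 1] [cite: GreenbergVatsal2000, Thm. (1.3)]
[cite: Castella2018Exceptional, Thm. 2.10 and Thm. 2.11] [cite: LiuZhangZhang2018, Thm. 1.5.1 and Thm. 1.5.3]
[cite: Greenberg2016Selmer, Props. 2.6.3, 4.1.1] [cite: Greenberg2006, Props. 3.2, 4.1, 4.2]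
[cite: CastellaGrossiLeeSkinner2022, Prop. 1.2.5, Cor. 1.2.6, Thm. 1.2.2, Thm. 2.1.2 (arXiv:2008.02571)] -/
theorem stub_publishedFacts :
    (((lambdaMu_multiplicative_of_gvPar ∧ thm16_charIdeal_dvd_multiplicative_of_reducible ∧
    thm61_splitMultiplicative ∧ thm61_nonsplitMultiplicative ∧
    (∀ (W : WeierstrassCurve ℚ) [W.IsElliptic] [W.IsGloballyMinimal] (p : ℕ) [Fact p.Prime],
      greenberg_stevens (W := W) (p := p)) ∧
    exists_isNewformOf ∧
    hsieh2014_exists_anticyclotomicPAdicLFunction ∧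
    (∀ (N : ℕ) [NeZero N] (W : WeierstrassCurve ℚ) (K : Type) [Field K] [NumberField K],
      gross_zagier N W K) ∧
    (∀ (N : ℕ) [NeZero N] (W : WeierstrassCurve ℚ) (K : Type) [Field K] [NumberField K],
      kolyvagin N W K) ∧
    rank_eq_analyticRank_of_analyticRank_le_one ∧ HoffsteinLuo1997_exists_twist_L_one_ne_zero ∧
    mazur_not_dvd_maninConstant_of_odd ∧ bsdRHS_eq_of_isIsogenous) ∧
    thm210_thm211_bdpDisplay_pNew) ∧
    LiuZhangZhang2018.thm151_thm153_modularCurve_heegnerVector) ∧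
    (prop125_characterGrSelmerDual_torsion_muZero_dim ∧ prop263_sur_of_crk ∧
      cor126_residualCharacter_globalLift ∧ cor126_residualCharacter_localSurjective ∧ prop411_selmer_isAlmostDivisible ∧
      prop41_globalEulerPoincareCorank ∧ prop42_localEulerPoincareCorank ∧ prop32_cohomology_isCofinitelyGenerated ∧
      thm212_exists_isKatzLFunction ∧
      CastellaGrossiLeeSkinner2022.thm122_fe_omegaPartner_charGrDual_torsion_muZero_lambda_eq ∧
      CastellaGrossiLeeSkinner2022.thm122_charGrDual_torsion_muZero_firstUnit_lambda_eq ∧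
      Literature.NumberTheory.EllipticCurves.Castella2018.cas20_thm211_memberForms_sigmaFrames_congr) := by
  sorry

/-- **stub_roadHFittingRevDiv** [NEW — the load-bearing stub of line «conglim»; member level, size XL]: at every X2c Heegner
datum (`CellC W p`, `(p) = 𝔭𝔭̄` split in `K`, `𝔭` through `ι′`) and every `𝓞_{ℂ_p}`-frame `Q` of `𝓛^BDP` at `(ι′, 𝔭)`:
`(Fitt⁰_Λ X_ac^∅ strict at 𝔭̄) · 𝓞_{ℂ_p}⟦T⟧ ⊆ (Q)`. TEXT = the binder `hfitt` of `Theorems.hidaLimitRevDivOnTreeIntOther_of_map_fittingIdeal_le`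
(c3h g4) token for token, universally closed over `W`, `p`. Intended proof = ROAD H at member level (card conglim S1–S4): crystalline
member package on `f_E`'s Hida branch (reducible `E[p]`: the CM-congruent members of Castella 2020 Thm. 2.11, NOT Skinner 2016's
irreducible `HidaCongruentMember`), member-wise Greenberg-direction divisibility `Ch_Λ(X^Σ(g_m)) ⊆ (L_Σ(g_m))` (three-variable
Eisenstein-congruence method, Wan 2020 / Castella Thm. 2.3 shape, at GOOD ordinary members), Selmer specialisation congruences, then the
LANDED congruence-limit kernel `Castella2018.AcSelmer.XAc.map_fittingIdeal_le_span_of_oneSided_congruences_descent_le_cpInt` and the Σ-strip.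
WHY IT MIGHT FAIL: the member-wise Greenberg-direction divisibility is printed only for residually IRREDUCIBLE, p-distinguished members
(Wan 2020 Thm. 1.1 hypotheses); at an Eisenstein branch the CM-congruent members have reducible residual representation too — the
three-variable argument's Gorenstein / multiplicity-one inputs are exactly what is missing (Castella erratum); no uniform-in-`m` bound on
the congruence defect is in print. [claim: KellerYin2024, status: under-review]
[cite: KellerYin2024, §5.1 (a)–(e), Lemma 5.1.2 (arXiv:2402.12781v2)] [cite: Castella2018, Thm. 2.3 (arXiv:1704.06608 p. 5)]
[cite: SkinnerUrban2014, §3.1.6] [cite: Wan2020, Thm. 1.1] [cite: JetchevSkinnerWan2017, §5.3.4–§5.3.8] -/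
theorem stub_roadHFittingRevDiv :
    ∀ (W : WeierstrassCurve ℚ) [W.IsElliptic] [W.IsGloballyMinimal] (p : ℕ) [Fact p.Prime],
    ∀ (N : ℕ) [NeZero N] (K : Type) [Field K] [NumberField K]
      (Dt : ModularParametrizationData W N)
      (H : HeegnerDatum N (NumberField.discr K)) (ιK : K →+* ℂ) (P : (W.baseChange K).toAffine.Point),
      CellC W p → W.conductorNorm ℤ = N →
      IsImaginaryQuadratic K → NumberField.discr K < -4 → SatisfiesHeegnerHypothesis N K →
      (W.quadraticTwist (NumberField.discr K : ℚ)).entireLFunction 1 ≠ 0 →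
      WeierstrassCurve.Affine.Point.map ιK.toRatAlgHom P = heegnerPointComplex Dt H →
      ¬ (p : ℤ) ∣ Dt.c → ¬ IsOfFinAddOrder P →
      Odd (NumberField.discr K) →
      ∀ (κ : ZpExtension K p), κ.IsAnticyclotomic →
        ∀ (γ : Field.absoluteGaloisGroup K) [Fact (κ.IsTopGenerator γ)]
          (𝔭 : HeightOneSpectrum (𝓞 K)), ((p : ℕ) : 𝓞 K) ∈ 𝔭.asIdeal →
          𝔭.asIdeal.ramificationIdx (𝓞 ℚ) = 1 → 𝔭.asIdeal.inertiaDeg (𝓞 ℚ) = 1 →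
          ∀ (𝔭bar : HeightOneSpectrum (𝓞 K)), ((p : ℕ) : 𝓞 K) ∈ 𝔭bar.asIdeal → 𝔭bar ≠ 𝔭 →
            ((Ideal.span {(p : ℤ)}).primesOver (𝓞 K)).ncard = 2 →
          ∀ (f : CuspForm (CongruenceSubgroup.Gamma0 N) 2), IsNewformOf W f →
            ∀ (ι' : PadicAlgCl p ≃+* ℂ),
              (∀ (w : InfinitePlace K) (k : 𝓞 K),
                k ∈ 𝔭.asIdeal ↔ ‖ι'.symm (w.embedding (k : K))‖ < 1) →
              ∀ (ΩK : ℂ) (Ωp : ℂ_[p]) (Q : PowerSeries 𝓞_ℂ_[p]), ΩK ≠ 0 → ‖Ωp‖ = 1 →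
                R1.IsBDPLFunctionInt p ι' 𝔭 κ γ f ΩK Ωp Q →
                  (Literature.RingTheory.FittingIdeal.Module.fittingIdeal (IwasawaAlgebra p)
                      (XAc (W.baseChange K) p κ 𝔭bar ∅ γ) 0).map
                      (PowerSeries.map (R1.toCpInt p)) ≤ Ideal.span {Q} := by
  sorry

/-- **stub_lambdaUpperNonsplit** [NEW as a stub; kernel M; no unprinted input beyond the record's]: at every NON-SPLIT X2c Heegner datum with
`d_K` odd and every `𝓞_{ℂ_p}`-frame `Q` at `(ι′, 𝔭)` with first unit coefficient at `m`: `λ(X_ac^∅ strict at 𝔭̄) ≤ m` — the UPPER half of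
Keller–Yin `algmain` (Thm. 5.1.3 (d)⇒(e)) at the p-new point, i.e. the MIRROR of the record's lower imprimitive count `hcountN`. Intended proof
(four pieces, three in the tree): (α) the non-split devissage EQUALITY `λ(X^{Sf}) = λ(X_θsub) + λ(X_θquot) + ΣΣ λ𝒫_w(θ)`
(`GrSelmerQuotientCorankLe.lambdaInvariant_xAc_eq_add_add_sum_of_not_split_of_facts`, nine PUB facts of `stub_publishedFacts.2`); (β) the wall
`λ(X_θ) = n_θ` (`stub_wallAlgebraic` + CGLS Thm. 1.2.2 PUB conjuncts); (γ) the member analytic count (ii) `m + Σ_w λ𝒫_w(f) = 2 n_φ + ΣΣ λ𝒫_w(θ)` read as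
an EQUALITY through the index-preserving crystalline transport (`CrystalTransports.han_of_crystallineFibre_of_memberInvariants` gives `≤`; the reverse
needs (ii) exact, `KellerYin2024.thm222_anacong_hidaMember_sigma_lambda_OPEN`); (δ) the `≥` HALF of the f-side Σ-relaxation
`λ(X^∅) + Σ_w λ𝒫_w(f) ≤ λ(X^{Sf})`, i.e. `corank_{ℤ_p}(Sel^{Sf}/Sel^∅) ≥ Σ_w λ𝒫_w(f)` — global-to-local SURJECTIVITY for the `Sf`-relaxed anticyclotomic
deformation of `T_pE` (Greenberg 2016 Prop. 2.6.3 = `prop263_sur_of_crk`, a PUB conjunct of `stub_publishedFacts.2`; curve-level packaging after the tree's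
`AcTwistDeformationCurveSUR.primaryTorsion_fullAt_SUR`, corank algebra after `UnrSelmerQuotientCorankGeOfSurjective.zpCorank_quotient_eq_sum_of_surjective`;
the exact decomposition `λ(X^{Sf}) = λ(X^∅) + corank` is KERNEL, p564629). NOTE: the record needs only the `≤` half (kernel, p564629 + p620653); the JSW
containment `Ch(X^∅)·(P_Σ) ⊆ Ch(X^{Sf})` is that same `≤` half and does NOT give (δ).
WHY IT MIGHT FAIL: (γ) reversed needs the member count as an equality at EVERY member and the transport to be exact in both directions (the tree
proves one); (δ) needs LEO/CRK for the `Sf`-relaxed deformation datum (Greenberg 2006 Props. 4.1/4.2, PUB) and `E(K_∞)[p] = 0`-type hypotheses at a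
reducible `p` (here `E(K)[p]` may be non-zero on X2c: the rational `p`-isogeny), which is where Prop. 2.6.3's case analysis must be done with care.
[claim: KellerYin2024, status: under-review]
[cite: KellerYin2024, Thm. 1.4.1, Prop. 1.2.5, Lemma 5.1.1, Thm. 5.1.3 (arXiv:2402.12781v2)] [cite: CastellaGrossiLeeSkinner2022, Prop. 1.2.5, (eq:lambda-imp)]
[cite: Greenberg2016Selmer, Props. 2.6.3, 4.1.1] [cite: GreenbergVatsal2000, §2 Prop. (2.1), Cor. (2.3)] -/
theorem stub_lambdaUpperNonsplit :
    ∀ (W : WeierstrassCurve ℚ) [W.IsElliptic] [W.IsGloballyMinimal] (p : ℕ) [Fact p.Prime],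
      ∀ (N : ℕ) [NeZero N] (K : Type) [Field K] [NumberField K] (Dt : ModularParametrizationData W N)
        (H : HeegnerDatum N (NumberField.discr K)) (ιK : K →+* ℂ) (P : (W.baseChange K).toAffine.Point),
        CellC W p → ¬ W.HasSplitMultiplicativeReductionAtPrime p → W.conductorNorm ℤ = N →
        IsImaginaryQuadratic K → NumberField.discr K < -4 → SatisfiesHeegnerHypothesis N K →
        (W.quadraticTwist (NumberField.discr K : ℚ)).entireLFunction 1 ≠ 0 →
        WeierstrassCurve.Affine.Point.map ιK.toRatAlgHom P = heegnerPointComplex Dt H →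
        ¬ (p : ℤ) ∣ Dt.c → ¬ IsOfFinAddOrder P →
        Odd (NumberField.discr K) →
        ∀ (κ : ZpExtension K p), κ.IsAnticyclotomic →
          ∀ (γ : Field.absoluteGaloisGroup K) [Fact (κ.IsTopGenerator γ)]
            (𝔭 : HeightOneSpectrum (𝓞 K)), ((p : ℕ) : 𝓞 K) ∈ 𝔭.asIdeal →
            𝔭.asIdeal.ramificationIdx (𝓞 ℚ) = 1 → 𝔭.asIdeal.inertiaDeg (𝓞 ℚ) = 1 →
            ∀ (𝔭bar : HeightOneSpectrum (𝓞 K)), ((p : ℕ) : 𝓞 K) ∈ 𝔭bar.asIdeal → 𝔭bar ≠ 𝔭 →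
              ((Ideal.span {(p : ℤ)}).primesOver (𝓞 K)).ncard = 2 →
            ∀ (f : CuspForm (CongruenceSubgroup.Gamma0 N) 2), IsNewformOf W f →
              ∀ (ι' : PadicAlgCl p ≃+* ℂ),
                (∀ (w : InfinitePlace K) (k : 𝓞 K),
                  k ∈ 𝔭.asIdeal ↔ ‖ι'.symm (w.embedding (k : K))‖ < 1) →
                ∀ (ΩK : ℂ) (Ωp : ℂ_[p]) (Q : PowerSeries 𝓞_ℂ_[p]), ΩK ≠ 0 → ‖Ωp‖ = 1 →
                  R1.IsBDPLFunctionInt p ι' 𝔭 κ γ f ΩK Ωp Q →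
                      ∀ m : ℕ, ‖((PowerSeries.coeff m Q : 𝓞_ℂ_[p]) : ℂ_[p])‖ = 1 →
                        (∀ i < m, ‖((PowerSeries.coeff i Q : 𝓞_ℂ_[p]) : ℂ_[p])‖ < 1) →
                          lambdaInvariant p (XAc (W.baseChange K) p κ 𝔭bar ∅ γ) ≤ m := by
  sorry

/-- **stub_lambdaUpperSplit** [NEW as a stub; kernel L; ONE unprinted-as-stated input]: the SPLIT twin of `stub_lambdaUpperNonsplit` —
at every SPLIT multiplicative X2c Heegner datum with `d_K` odd and every frame `Q` fuc at `m`: `λ(X_ac^∅ strict at 𝔭̄) ≤ m`. Intended proof: as the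
non-split stub with (α) replaced by the UPPER half of the split-row devissage count WITH the `−δ` correction,
`λ(X^{Sf}) + [θquot = 𝟙] ≤ λ(X_θsub) + λ(X_θquot) + ΣΣ λ𝒫_w(θ) + δ` (mirror of `SplitMultAlgebraicSide.lambdaInvariant_primitive_add_sum_le_of_split`,
orientation (ω, 𝟙), `θsub` ramified at `v̄`), and (β) by `stub_wallAlgebraic.2` ([BRω-split] light, `λ = n_φ`). WHY IT MIGHT FAIL: the split-row upper
count is not in print as stated (Keller–Yin Thm. 1.4.1 (iii) gives the lower half; the local condition at `v̄` for `θsub|_{G_v̄} = ω` contributes a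
defect `δ ∈ {0, 1}` whose sign in the upper bound must match the analytic side's trivial-zero order). [claim: KellerYin2024, status: under-review]
[cite: KellerYin2024, Thm. 1.4.1 (iii), §5.1 (arXiv:2402.12781v2)] [cite: CastellaGrossiLeeSkinner2022, Prop. 1.2.5] [cite: Greenberg2016Selmer, Prop. 2.6.3] -/
theorem stub_lambdaUpperSplit :
    ∀ (W : WeierstrassCurve ℚ) [W.IsElliptic] [W.IsGloballyMinimal] (p : ℕ) [Fact p.Prime],
      ∀ (N : ℕ) [NeZero N] (K : Type) [Field K] [NumberField K] (Dt : ModularParametrizationData W N)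
        (H : HeegnerDatum N (NumberField.discr K)) (ιK : K →+* ℂ) (P : (W.baseChange K).toAffine.Point),
        CellC W p → W.HasSplitMultiplicativeReductionAtPrime p → W.conductorNorm ℤ = N →
        IsImaginaryQuadratic K → NumberField.discr K < -4 → SatisfiesHeegnerHypothesis N K →
        (W.quadraticTwist (NumberField.discr K : ℚ)).entireLFunction 1 ≠ 0 →
        WeierstrassCurve.Affine.Point.map ιK.toRatAlgHom P = heegnerPointComplex Dt H →
        ¬ (p : ℤ) ∣ Dt.c → ¬ IsOfFinAddOrder P →
        Odd (NumberField.discr K) →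
        ∀ (κ : ZpExtension K p), κ.IsAnticyclotomic →
          ∀ (γ : Field.absoluteGaloisGroup K) [Fact (κ.IsTopGenerator γ)]
            (𝔭 : HeightOneSpectrum (𝓞 K)), ((p : ℕ) : 𝓞 K) ∈ 𝔭.asIdeal →
            𝔭.asIdeal.ramificationIdx (𝓞 ℚ) = 1 → 𝔭.asIdeal.inertiaDeg (𝓞 ℚ) = 1 →
            ∀ (𝔭bar : HeightOneSpectrum (𝓞 K)), ((p : ℕ) : 𝓞 K) ∈ 𝔭bar.asIdeal → 𝔭bar ≠ 𝔭 →
              ((Ideal.span {(p : ℤ)}).primesOver (𝓞 K)).ncard = 2 →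
            ∀ (f : CuspForm (CongruenceSubgroup.Gamma0 N) 2), IsNewformOf W f →
              ∀ (ι' : PadicAlgCl p ≃+* ℂ),
                (∀ (w : InfinitePlace K) (k : 𝓞 K),
                  k ∈ 𝔭.asIdeal ↔ ‖ι'.symm (w.embedding (k : K))‖ < 1) →
                ∀ (ΩK : ℂ) (Ωp : ℂ_[p]) (Q : PowerSeries 𝓞_ℂ_[p]), ΩK ≠ 0 → ‖Ωp‖ = 1 →
                  R1.IsBDPLFunctionInt p ι' 𝔭 κ γ f ΩK Ωp Q →
                      ∀ m : ℕ, ‖((PowerSeries.coeff m Q : 𝓞_ℂ_[p]) : ℂ_[p])‖ = 1 →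
                        (∀ i < m, ‖((PowerSeries.coeff i Q : 𝓞_ℂ_[p]) : ℂ_[p])‖ < 1) →
                          lambdaInvariant p (XAc (W.baseChange K) p κ 𝔭bar ∅ γ) ≤ m := by
  sorry

/-- **stub_memberInvariants** := the record's (crystal v10) text VERBATIM: Keller–Yin Thm. 2.2.2 (anacong) at the crystalline members, `μ` and `λ`
statements. [claim: KellerYin2024, status: under-review] [cite: KellerYin2024, Thm. 2.2.2 (arXiv:2402.12781v2 p. 18)]
[cite: CastellaGrossiLeeSkinner2022, Thm. 2.2.1 and Thm. 2.2.2 with (2.16)] -/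
theorem stub_memberInvariants :
    Literature.NumberTheory.EllipticCurves.KellerYin2024.thm222_anacong_hidaMember_sigma_mu_OPEN ∧
      Literature.NumberTheory.EllipticCurves.KellerYin2024.thm222_anacong_hidaMember_sigma_lambda_OPEN := by
  sorry

/-- **stub_wallAlgebraic** := the record's (crystal v10) text VERBATIM ([BR𝟙-anom] ∧ [BRω-split] light). [claim: KellerYin2024, status: under-review]
[cite: KellerYin2024, Thm. 1.2.2, Lemma 1.2.4 (arXiv:2402.12781v2)] [cite: CastellaGrossiLeeSkinner2022, Thm. 1.2.2 with (2.16)] -/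
theorem stub_wallAlgebraic :
    (∀ (p : ℕ) [Fact p.Prime],
      2 < p → ∀ (K : Type) [Field K] [NumberField K], IsImaginaryQuadratic K →
        SatisfiesHeegnerHypothesis p K → Odd (NumberField.discr K) → NumberField.discr K ≠ -3 →
      ∀ (ι : K →+* ℚ_[p]) (v vbar : HeightOneSpectrum (𝓞 K)),
        (∀ x : 𝓞 K, x ∈ v.asIdeal ↔ ‖ι (x : K)‖ < 1) →
        ((p : ℕ) : 𝓞 K) ∈ vbar.asIdeal → vbar ≠ v →
      ∀ (κ : ZpExtension K p), κ.IsAnticyclotomic →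
      ∀ (γ : absoluteGaloisGroup K) [Fact (κ.IsTopGenerator γ)],
      ∀ (ι' : PadicAlgCl p ≃+* ℂ),
        (∀ (w : InfinitePlace K) (k : 𝓞 K), k ∈ v.asIdeal ↔ ‖ι'.symm (w.embedding (k : K))‖ < 1) →
      ∀ (θ : FramedGaloisRep ℚ (padicCoeffIntegers (∅ : Set (PadicAlgCl p))) 1),
        (∀ σ : absoluteGaloisGroup ℚ, θ σ ^ (p - 1) = 1) →
      ∀ (C : ℕ), SatisfiesHeegnerHypothesis C K →
        (∀ u : HeightOneSpectrum (𝓞 ℚ), ((C : ℤ) : 𝓞 ℚ) ∉ u.asIdeal → θ.IsUnramifiedAt u) →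
        (∀ u : HeightOneSpectrum (𝓞 ℚ), ((p : ℕ) : 𝓞 ℚ) ∈ u.asIdeal → θ.IsUnramifiedAt u) →
        (∀ g ∈ decomp vbar, ∀ m : charModule (∅ : Set (PadicAlgCl p)) (θ.restrictField K), p • m = 0 → g • m = m) →
      ∀ (θK : HeckeCharacter K), IsHeckeCharOf ι' (θ.restrictField K) θK →
      ∀ (D : DatumDualData κ γ (charModule (∅ : Set (PadicAlgCl p)) (θ.restrictField K))
          (Castella2018.AcSelmer.bdpData (charModule (∅ : Set (PadicAlgCl p)) (θ.restrictField K)) p vbar)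
          (∅ : Set (HeightOneSpectrum (𝓞 K)))),
      ∀ (Cbar : Finset (HeightOneSpectrum (𝓞 K))), (∀ u ∈ Cbar, ¬ θK.IsUnramifiedAt u) →
      ∀ (ΩK : ℂ) (Ωp : (unrIntegers p)ˣ) (L : UnrSeries p), ΩK ≠ 0 →
        IsKatzLFunction ι' v vbar Cbar κ γ θK ΩK ((Ωp : unrIntegers p) : ℂ_[p]) L →
      Module.Finite (IwasawaAlgebra p) D.X ∧ Module.IsTorsion (IwasawaAlgebra p) D.X ∧
        muInvariant p D.X = 0 ∧
        ∃ m : ℕ, FirstUnitCoeffAt L m ∧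
          lambdaInvariant p D.X =
            m + (if ∀ σ : absoluteGaloisGroup K, θ.restrictField K σ = 1 then 1 else 0)) ∧
      (∀ (W : WeierstrassCurve ℚ) [W.IsElliptic] [W.IsGloballyMinimal] (p : ℕ) [Fact p.Prime],
      2 < p → Mult W p → W.HasSplitMultiplicativeReductionAtPrime p →
      ∀ (K : Type) [Field K] [NumberField K],
        IsImaginaryQuadratic K → SatisfiesHeegnerHypothesis (W.conductorNorm ℤ) K →
        Odd (NumberField.discr K) → NumberField.discr K ≠ -3 →
        ∀ (κ : ZpExtension K p), κ.IsAnticyclotomic →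
          ∀ (γ : Field.absoluteGaloisGroup K) [Fact (κ.IsTopGenerator γ)]
            (𝔭 : HeightOneSpectrum (𝓞 K)), ((p : ℕ) : 𝓞 K) ∈ 𝔭.asIdeal →
            𝔭.asIdeal.ramificationIdx (𝓞 ℚ) = 1 → 𝔭.asIdeal.inertiaDeg (𝓞 ℚ) = 1 →
            ∀ (𝔭bar : HeightOneSpectrum (𝓞 K)), ((p : ℕ) : 𝓞 K) ∈ 𝔭bar.asIdeal → 𝔭bar ≠ 𝔭 →
              ((Ideal.span {(p : ℤ)}).primesOver (𝓞 K)).ncard = 2 →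
            ∀ (ι' : PadicAlgCl p ≃+* ℂ),
              (∀ (w : InfinitePlace K) (k : 𝓞 K), k ∈ 𝔭.asIdeal ↔ ‖ι'.symm (w.embedding (k : K))‖ < 1) →
            ∀ (Φ : AddSubgroup (geomTorsion W (p : ℤ))), IsRationalLine W p Φ →
            ∀ (θsub θquot : FramedGaloisRep ℚ (padicCoeffIntegers (∅ : Set (PadicAlgCl p))) 1),
              IsTeichmullerLiftOn (∅ : Set (PadicAlgCl p)) (Φ.map (geomTorsion W (p : ℤ)).subtype) θsub →
              IsTeichmullerLiftOnQuot (∅ : Set (PadicAlgCl p)) (Φ.map (geomTorsion W (p : ℤ)).subtype)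
                (geomTorsion W (p : ℤ)) θquot →
            ∀ (φ ψ : FramedGaloisRep ℚ (padicCoeffIntegers (∅ : Set (PadicAlgCl p))) 1),
              (φ = θsub ∧ ψ = θquot ∨ φ = θquot ∧ ψ = θsub) →
              (∀ u : HeightOneSpectrum (𝓞 ℚ), ((p : ℕ) : 𝓞 ℚ) ∈ u.asIdeal → φ.IsUnramifiedAt u) →
            ∀ (θK : HeckeCharacter K), IsHeckeCharOf ι' (φ.restrictField K) θK →
            ∀ (Cbar : Finset (HeightOneSpectrum (𝓞 K))), (∀ u ∈ Cbar, ¬ θK.IsUnramifiedAt u) →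
            ∀ (ΩK' : ℂ) (Ωp' : (unrIntegers p)ˣ) (Lφ : UnrSeries p), ΩK' ≠ 0 →
              IsKatzLFunction ι' 𝔭 𝔭bar Cbar κ γ θK ΩK' ((Ωp' : unrIntegers p) : ℂ_[p]) Lφ →
            ∀ nφ : ℕ, FirstUnitCoeffAt Lφ nφ →
            ∀ (Dψ : DatumDualData κ γ (charModule (∅ : Set (PadicAlgCl p)) (ψ.restrictField K))
                (Castella2018.AcSelmer.bdpData (charModule (∅ : Set (PadicAlgCl p)) (ψ.restrictField K)) p 𝔭bar)
                (∅ : Set (HeightOneSpectrum (𝓞 K)))),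
              Module.Finite (IwasawaAlgebra p) Dψ.X ∧ Module.IsTorsion (IwasawaAlgebra p) Dψ.X ∧
                muInvariant p Dψ.X = 0 ∧ lambdaInvariant p Dψ.X = nφ) := by
  sorry

/-- **stub_mazurMC_cellB** := the route decl `MazurMCOnCellB` VERBATIM (crux 3, stmt-BirchSwinnertonDyer-19033). [cite: GreenbergVatsal2000, Thm. (1.3)] -/
theorem stub_mazurMC_cellB :
    Summit.BirchSwinnertonDyer.BirchSwinnertonDyer.Theses.EisensteinPrimes.MazurMCOnCellB := by
  sorry

/-- **THE COMPOSITION (conglim v1): crux 4 `BSDpOnCellC` BY NAME from the SEVEN stubs.** Zero binders; no sorry outside the stubs.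
b1's 17-tuple is REBUILT from `stub_publishedFacts.1` with the Poitou–Tate tree theorems (as the record does); Keller–Yin Lemma 5.1.1 from
`KellerYinLemma511OfBrAnom.lemma511_OPEN_of_prop125_of_brAnom_of_pub` (PUB facts + the wall); `μ(X_ac^∅ at 𝔭̄) = 0` from
`StubC3MultMuLemma.stub_muSelmer_of_lemma511_OPEN`; the `μ`-frame of `Q` from `CrystalTransports.muFrame_of_crystallineFibre_of_memberMuZero`
(crystalline fibre from `CrystallineFibreOfCas20.crystallineFibre_of_cas20`, member `μ = 0` from `MemberInvariantsOfAnacongWt.memberInvariants_of_anacongWt`);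
road H's output `X2.HidaLimitRevDivOnTreeIntOther` on X2c from `Theorems.hidaLimitRevDivOnTreeIntOther_of_map_fittingIdeal_le` (torsion discharged);
the IMC atom from `BSDpOnCellCResidualPub.stub_c3_of_pub_of_hidaLimitRevDivIntOther_of_oneInequality`; the crux from
`Reoriented.bsdpOnCellC_of_stubs_reoriented` + `Reoriented.stub_c2_of_thm151_thm153`. CONDITIONAL; BSD is proved for no curve.
[cite: KellerYin2024, Thm. 5.1.3 = Thm. D (arXiv:2402.12781v2) (shape only)] -/
theorem BSDpOnCellC_of :
    Summit.BirchSwinnertonDyer.BirchSwinnertonDyer.Theses.EisensteinPrimes.BSDpOnCellC := by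
  obtain ⟨⟨⟨h1, h2, h3, h4, h5, h6, h9, h10, h11, h12, h13, h14, h15⟩, h16⟩, h17⟩ := stub_publishedFacts.1
  have hPub2 := stub_publishedFacts.2
  have hWall := stub_wallAlgebraic
  have hPT : ∀ (K : Type) [Field K] [NumberField K], poitouTate_selmerStructure_duality K := fun K _ _ ↦
    Summit.BirchSwinnertonDyer.BirchSwinnertonDyer.Theorems.SchneiderFreeAdditiveX3.PoitouTateReduction.poitouTate_selmerStructure_duality_holds K
  have hPT2 : ∀ (K : Type) [Field K] [NumberField K], poitouTate_sha_tateDual K := fun K _ _ ↦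
    Summit.BirchSwinnertonDyer.BirchSwinnertonDyer.Theorems.SchneiderFreeAdditiveX3.PoitouTateReduction.poitouTate_sha_tateDual_holds K
  -- Keller–Yin Thm. 2.2.2 at the crystalline members and Castella's crystalline fibre congruence, as in the record (x2-p2 g13)
  have hMemberI := Summit.BirchSwinnertonDyer.BirchSwinnertonDyer.Theorems.MemberInvariantsOfAnacongWt.memberInvariants_of_anacongWt
    stub_memberInvariants.1 stub_memberInvariants.2
  have hFibre := Summit.BirchSwinnertonDyer.BirchSwinnertonDyer.Theorems.CrystallineFibreOfCas20.crystallineFibre_of_cas20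
    hPub2.2.2.2.2.2.2.2.2.2.2.2
  -- Keller–Yin Lemma 5.1.1 (`μ(X^{S}) = 0`, both signs) from PUB facts + the wall; then `μ(X_ac^∅ strict at 𝔭̄) = 0` per datum
  have h511 : lemma511_imprimitive_isTorsion_muInvariant_eq_zero_mult_OPEN :=
    Summit.BirchSwinnertonDyer.BirchSwinnertonDyer.Theorems.KellerYinLemma511OfBrAnom.lemma511_OPEN_of_prop125_of_brAnom_of_pub
    hPub2.1 hPub2.2.1 hPub2.2.2.2.2.2.1 hPub2.2.2.2.2.2.2.1 Literature.NumberTheory.IwasawaTheory.Greenberg2006.sec5A_localH2_subsingleton_of_LOC1_holds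
    hPub2.2.2.2.2.2.2.2.1 hPub2.2.2.2.2.2.2.2.2.1 hWall.1 hWall.2
  have hμ := Summit.BirchSwinnertonDyer.BirchSwinnertonDyer.Theorems.StubC3MultMuLemma.stub_muSelmer_of_lemma511_OPEN h511
  -- the `μ`-frame of `Q` (first unit coefficient exists), both signs
  have hmuF := Summit.BirchSwinnertonDyer.BirchSwinnertonDyer.Theorems.CrystalTransports.muFrame_of_crystallineFibre_of_memberMuZero hFibre hMemberI.1
  -- road H's re-oriented output on X2c from the Fitting-form stub (torsion of `X_ac^∅` at `𝔭̄` discharged, c3h g4 §3–§4)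
  have hrev : ∀ (W : WeierstrassCurve ℚ) [W.IsElliptic] [W.IsGloballyMinimal] (p : ℕ) [Fact p.Prime],
      CellC W p → HidaLimitRevDivOnTreeIntOther W p := fun W _ _ p _ _ ↦
    Summit.BirchSwinnertonDyer.BirchSwinnertonDyer.Theorems.hidaLimitRevDivOnTreeIntOther_of_map_fittingIdeal_le h12 h6 hPT hPT2
      (stub_roadHFittingRevDiv W p)
  -- the IMC atom `stub_c3` (both signs) from road H + the road-H one-inequality, x2-p2 g2's ResidualPub §3
  have hc3 := Summit.BirchSwinnertonDyer.BirchSwinnertonDyer.Theorems.BSDpOnCellCResidualPub.stub_c3_of_pub_of_hidaLimitRevDivIntOther_of_oneInequality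
    h12 h6 hPT hPT2 hrev
    (fun W _ _ p _ N _ K _ _ Dt H ιK P hc hsg hN hK hd4 hHN hLt hP hcM hPinf hodd κ hκ γ _ 𝔭 h𝔭 he hf 𝔭bar h𝔭bar hne hsplit f hfW ι' hι' ΩK Ωp Q hΩK hΩp hQ ↦ by
      obtain ⟨m, hm, hlt⟩ := hmuF.1 W p N K Dt H ιK P hc hsg hN hK hd4 hHN hLt hP hcM hPinf hodd κ hκ γ 𝔭 h𝔭 he hf 𝔭bar h𝔭bar hne hsplit f hfW ι' hι' ΩK Ωp Q hΩK hΩp hQ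
      exact ⟨hμ.1 W p N K Dt H ιK P hc hsg hN hK hd4 hHN hLt hP hcM hPinf hodd κ hκ γ 𝔭 h𝔭 he hf 𝔭bar h𝔭bar hne hsplit f hfW ι' hι' ΩK Ωp Q hΩK hΩp hQ,
        m, stub_lambdaUpperNonsplit W p N K Dt H ιK P hc hsg hN hK hd4 hHN hLt hP hcM hPinf hodd κ hκ γ 𝔭 h𝔭 he hf 𝔭bar h𝔭bar hne hsplit f hfW ι' hι' ΩK Ωp Q hΩK hΩp hQ m hm hlt,
        hm, hlt⟩)
    (fun W _ _ p _ N _ K _ _ Dt H ιK P hc hsg hN hK hd4 hHN hLt hP hcM hPinf hodd κ hκ γ _ 𝔭 h𝔭 he hf 𝔭bar h𝔭bar hne hsplit f hfW ι' hι' ΩK Ωp Q hΩK hΩp hQ ↦ by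
      obtain ⟨m, hm, hlt⟩ := hmuF.2 W p N K Dt H ιK P hc hsg hN hK hd4 hHN hLt hP hcM hPinf hodd κ hκ γ 𝔭 h𝔭 he hf 𝔭bar h𝔭bar hne hsplit f hfW ι' hι' ΩK Ωp Q hΩK hΩp hQ
      exact ⟨hμ.2 W p N K Dt H ιK P hc hsg hN hK hd4 hHN hLt hP hcM hPinf hodd κ hκ γ 𝔭 h𝔭 he hf 𝔭bar h𝔭bar hne hsplit f hfW ι' hι' ΩK Ωp Q hΩK hΩp hQ,
        m, stub_lambdaUpperSplit W p N K Dt H ιK P hc hsg hN hK hd4 hHN hLt hP hcM hPinf hodd κ hκ γ 𝔭 h𝔭 he hf 𝔭bar h𝔭bar hne hsplit f hfW ι' hι' ΩK Ωp Q hΩK hΩp hQ m hm hlt,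
        hm, hlt⟩)
  exact Summit.BirchSwinnertonDyer.BirchSwinnertonDyer.Theorems.Reoriented.bsdpOnCellC_of_stubs_reoriented
    ⟨⟨h1, h2, h3, h4, h5, h6, hPT, hPT2, h9, h10, h11, h12, h13, h14, h15⟩, h16⟩
    (Summit.BirchSwinnertonDyer.BirchSwinnertonDyer.Theorems.Reoriented.stub_c2_of_thm151_thm153 h17) hc3 stub_mazurMC_cellB

end Summit.BirchSwinnertonDyer.BirchSwinnertonDyer.Cruxes.BSDpOnCellC.Conglim

end
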